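import Mathlib
import HarnessLib
import Summits.ResolutionOfSingularities.ResolutionOfSingularities.Theorems.WildQuotientsWildQuotientResolutionJordanFiveChartW1Side
import Summits.ResolutionOfSingularities.ResolutionOfSingularities.Theorems.WildQuotientsWildQuotientResolutionJordanFiveChartW2Side

/-!
# RUNG V5 (`J₅`): the seams at `chartW₁`, `chartW₂` in the ring-brick (`appLE`) spelling
(crux stmt-ResolutionOfSingularities-15640 `WildQuotients.WildQuotientResolution`, line `Sketch`;
chain w45c RUNG V5 — res-L1-w45c-lead-1's ring-brick adapters `JordanFive.coneBrick_one_of_ringBrick` /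
`coneBrick_two_of_ringBrick` (stubs/JordanFiveRingBrickOne/Two.lean, 12:52Z; plan-1 COORDINATION
13:00:46Z) phrase the ring bricks `H₁` (at `W₁ = chartW₁ ≤ V[H′²]`, ratios `T_j·H′² = g_j`, `j ≠ 1`)
and `H₂` (at `W₂ = chartW₂ ≤ V[i₂³]`, ratios `T_j·i₂³ = g_j`) with sections pushed through the principal
chart `V[u]` — exactly the J₄ `H₀`/`H₁` pattern (p508076/p512651). These corollaries of the seams
p527645/p530098 deliver clause (i) in that spelling, (i′)
`(O.ι.appLE V _ hle) ((π.appLE ⊤ V _) (ι₀ f)) = Ω (f/1)`, so that `JordanFour.ringBrick_transport`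
(p519150, small types) turns any RING-SIDE brick in `(k[x][I₁₂t])_{(s)}` into `H₁`/`H₂` by ONE `exact`
(the `brickH1W` recipe). Written by res-D-pv-033 AS res-L1-w45c-stub-5 for res-L1-w45c-stub-1/stub-2
(`H₁`) and res-type-036 (`H₂`). [OURS · L1 W4.5c] — NOT a statement of any manuscript.)
-/

-- single-problem summit: the doubled namespace component `ResolutionOfSingularities` is forced
set_option linter.dupNamespace false

noncomputable section

open CategoryTheory AlgebraicGeometry TopologicalSpace MvPolynomial Polynomial HomogeneousLocalization
open Literature.AlgebraicGeometry.Resolution Literature.AlgebraicGeometry.RelativeSpec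
open scoped Pointwise

namespace Summit.ResolutionOfSingularities.ResolutionOfSingularities.Theorems.WildQuotientResolution.JordanFive

variable (k : Type) [Field k] (n : ℕ) (σ : MvPolynomial (Fin n) k ≃ₐ[k] MvPolynomial (Fin n) k)
  (a b c d e : Fin n) (hab : a ≠ b) (hac : a ≠ c) (had : a ≠ d) (hae : a ≠ e)
  (hb : σ (X b) = X b + X a) (hc : σ (X c) = X c + X b) (hd : σ (X d) = X d + X c)
  (he : σ (X e) = X e + X d)
  (hσ : ∀ i, i ≠ b → i ≠ c → i ≠ d → i ≠ e → σ (X i) = X i)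

/-- `k[x] → Γ(Spec k[x], ⊤)` (local shorthand) -/
local notation3 "ι₀" => (Scheme.ΓSpecIso (CommRingCat.of (MvPolynomial (Fin n) k))).inv.hom
/-- the quotient map `q : 𝔸ⁿ → 𝔸ⁿ/⟨σ⟩` (local shorthand) -/
local notation3 "qσ" => Spec.map (CommRingCat.ofHom (algebraMap
  (FixedPoints.subalgebra k (MvPolynomial (Fin n) k) (Subgroup.zpowers σ)) (MvPolynomial (Fin n) k)))

include hab hac had hae hb hc hd hσ in
-- large literal binders
set_option maxHeartbeats 4000000 in
/-- **The seam at `chartW₁` in the ring-brick `appLE` spelling** (res-L1-w45c-lead-1's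
`coneBrick_one_of_ringBrick` binder `H₁`: `hle` over the principal chart `V[H′²]`,
(i′) `(O₁.ι)^* ((π^* f)|_V) = Ω (f/1)`) — so `JordanFour.ringBrick_transport` (p519150) applies
verbatim with `r := O₁.1.ι.appLE V _ hle`, `πapp := π.appLE ⊤ V _`, `base := f ↦ f/1`.
[OURS · L1 W4.5c] [folklore; assembly of landed decls] -/
theorem exists_sectionsEquiv_chartW₁_appLE
    (hI : ∀ g : ↥(Subgroup.zpowers σ), g • I12 k n a b c d = I12 k n a b c d)
    (ρ : ↥(Subgroup.zpowers σ) →* Aut (Spec (CommRingCat.of (MvPolynomial (Fin n) k))))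
    (hρ : ∀ g : ↥(Subgroup.zpowers σ), (ρ g).hom = Spec.map (CommRingCat.ofHom
      ((MulSemiringAction.toRingEquiv (↥(Subgroup.zpowers σ)) (MvPolynomial (Fin n) k) g⁻¹ :
        MvPolynomial (Fin n) k ≃+* MvPolynomial (Fin n) k) :
          MvPolynomial (Fin n) k →+* MvPolynomial (Fin n) k)))
    (hJρ : ∀ g : ↥(Subgroup.zpowers σ),
      (affineBlowup.idealSheaf (I12 k n a b c d)).comap (ρ g).hom =
        affineBlowup.idealSheaf (I12 k n a b c d))
    (ρB : ActionOver (affineBlowup.π (I12 k n a b c d) ≫ qσ) ↥(Subgroup.zpowers σ))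
    (haut : ρB.aut = (affineBlowup.isBlowup (I12 k n a b c d)).liftAction ρ hJρ)
    (O₁ : ρB.StableAffineOpens) (hO₁ : O₁.1 = chartW₁ k n a b c d)
    (hle : ((O₁.1.ι ≫ affineBlowup.π (I12 k n a b c d) ≫ qσ) ⁻¹ᵁ ⊤ : (O₁.1 : Scheme.{0}).Opens) ≤
      O₁.1.ι ⁻¹ᵁ blowupChart (affineBlowup.π (I12 k n a b c d))
          (affineBlowup.idealSheaf (I12 k n a b c d)) ⟨⊤, isAffineOpen_top _⟩ (ι₀ (JordanFour.hPrime k n a b c ^ 2))) :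
    ∃ (φ : ↥(Subgroup.zpowers σ) → (reesGrading (I12 k n a b c d) →+*ᵍ reesGrading (I12 k n a b c d)))
      (hP : ∀ g, Submonoid.powers (reesT (JordanFour.hPrime k n a b c ^ 2)
          (hPrime_sq_mem_I12 k n a b c d) * tSqHT2 k n a b c d) ≤
        (Submonoid.powers (reesT (JordanFour.hPrime k n a b c ^ 2)
          (hPrime_sq_mem_I12 k n a b c d) * tSqHT2 k n a b c d)).comap (φ g))
      (Ω : HomogeneousLocalization.Away (reesGrading (I12 k n a b c d))
          (reesT (JordanFour.hPrime k n a b c ^ 2) (hPrime_sq_mem_I12 k n a b c d) *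
            tSqHT2 k n a b c d) ≃+*
        Γ((O₁.1 : Scheme.{0}), (O₁.1.ι ≫ affineBlowup.π (I12 k n a b c d) ≫ qσ) ⁻¹ᵁ ⊤)),
      (∀ (g : ↥(Subgroup.zpowers σ)) x, ((φ g x : reesAlgebra (I12 k n a b c d)) :
          (MvPolynomial (Fin n) k)[X]) =
        (x : (MvPolynomial (Fin n) k)[X]).map ((MulSemiringAction.toRingEquiv
          (↥(Subgroup.zpowers σ)) (MvPolynomial (Fin n) k) g⁻¹ : _ ≃+* _) : _ →+* _)) ∧
      (∀ f : MvPolynomial (Fin n) k,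
        O₁.1.ι.appLE (blowupChart (affineBlowup.π (I12 k n a b c d))
          (affineBlowup.idealSheaf (I12 k n a b c d)) ⟨⊤, isAffineOpen_top _⟩ (ι₀ (JordanFour.hPrime k n a b c ^ 2)))
          ((O₁.1.ι ≫ affineBlowup.π (I12 k n a b c d) ≫ qσ) ⁻¹ᵁ ⊤) hle
          ((affineBlowup.π (I12 k n a b c d)).appLE ⊤
            (blowupChart (affineBlowup.π (I12 k n a b c d))
          (affineBlowup.idealSheaf (I12 k n a b c d)) ⟨⊤, isAffineOpen_top _⟩ (ι₀ (JordanFour.hPrime k n a b c ^ 2)))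
            (blowupChart_le_preimage _ _ _ _) (ι₀ f)) =
        Ω (((fromZeroRingHom (reesGrading (I12 k n a b c d)) (.powers _)).comp
          (reesGrading.zeroRingHom (I12 k n a b c d))) f)) ∧
      (∀ (g : ↥(Subgroup.zpowers σ)) y, (ρB.restrict O₁.1 O₁.2.1).act g ⊤ (Ω y) =
        Ω (HomogeneousLocalization.map (φ g⁻¹) (hP g⁻¹) y)) ∧
      (∀ y, Ω y ∈ (ρB.restrict O₁.1 O₁.2.1).invariantsRing ⊤ ↔
        ∀ g, HomogeneousLocalization.map (φ g) (hP g) y = y) := by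
  have H := exists_sectionsEquiv_chartW₁ k n σ a b c d e hab hac had hae hb hc hd hσ hI ρ hρ hJρ ρB haut O₁ hO₁
  rcases H with ⟨φ, hP, Ω, hφ, hΩi, hΩii, hΩiii⟩
  refine ⟨φ, hP, Ω, hφ, fun f => ?_, hΩii, hΩiii⟩
  -- (i') from (i) by composing the two `appLE`s
  rw [← CommRingCat.comp_apply, Scheme.Hom.appLE_comp_appLE]
  exact (hΩi f).symm

include hab hac had hae hb hc hd he hσ in
-- large literal binders
set_option maxHeartbeats 4000000 in
/-- **The seam at `chartW₂` in the ring-brick `appLE` spelling** (res-L1-w45c-lead-1's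
`coneBrick_two_of_ringBrick` binder `H₂`: `hle` over the principal chart `V[i₂³]`,
(i′) `(O₂.ι)^* ((π^* f)|_V) = Ω (f/1)`) — so `JordanFour.ringBrick_transport` (p519150) applies
verbatim with `r := O₂.1.ι.appLE V _ hle`, `πapp := π.appLE ⊤ V _`, `base := f ↦ f/1`.
[OURS · L1 W4.5c] [folklore; assembly of landed decls] -/
theorem exists_sectionsEquiv_chartW₂_appLE
    (hI : ∀ g : ↥(Subgroup.zpowers σ), g • I12 k n a b c d = I12 k n a b c d)
    (ρ : ↥(Subgroup.zpowers σ) →* Aut (Spec (CommRingCat.of (MvPolynomial (Fin n) k))))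
    (hρ : ∀ g : ↥(Subgroup.zpowers σ), (ρ g).hom = Spec.map (CommRingCat.ofHom
      ((MulSemiringAction.toRingEquiv (↥(Subgroup.zpowers σ)) (MvPolynomial (Fin n) k) g⁻¹ :
        MvPolynomial (Fin n) k ≃+* MvPolynomial (Fin n) k) :
          MvPolynomial (Fin n) k →+* MvPolynomial (Fin n) k)))
    (hJρ : ∀ g : ↥(Subgroup.zpowers σ),
      (affineBlowup.idealSheaf (I12 k n a b c d)).comap (ρ g).hom =
        affineBlowup.idealSheaf (I12 k n a b c d))
    (ρB : ActionOver (affineBlowup.π (I12 k n a b c d) ≫ qσ) ↥(Subgroup.zpowers σ))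
    (haut : ρB.aut = (affineBlowup.isBlowup (I12 k n a b c d)).liftAction ρ hJρ)
    (O₂ : ρB.StableAffineOpens) (hO₂ : O₂.1 = chartW₂ k n a b c d e)
    (hle : ((O₂.1.ι ≫ affineBlowup.π (I12 k n a b c d) ≫ qσ) ⁻¹ᵁ ⊤ : (O₂.1 : Scheme.{0}).Opens) ≤
      O₂.1.ι ⁻¹ᵁ blowupChart (affineBlowup.π (I12 k n a b c d))
          (affineBlowup.idealSheaf (I12 k n a b c d)) ⟨⊤, isAffineOpen_top _⟩ (ι₀ (iTwo k n a b c d e ^ 3))) :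
    ∃ (φ : ↥(Subgroup.zpowers σ) → (reesGrading (I12 k n a b c d) →+*ᵍ reesGrading (I12 k n a b c d)))
      (hP : ∀ g, Submonoid.powers (reesT (iTwo k n a b c d e ^ 3) (iTwo_cube_mem_I12 k n a b c d e) *
          reesT (jThreeTwo k n a b c d e ^ 2) (jThreeTwo_sq_mem_I12 k n a b c d e)) ≤
        (Submonoid.powers (reesT (iTwo k n a b c d e ^ 3) (iTwo_cube_mem_I12 k n a b c d e) *
          reesT (jThreeTwo k n a b c d e ^ 2) (jThreeTwo_sq_mem_I12 k n a b c d e))).comap (φ g))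
      (Ω : HomogeneousLocalization.Away (reesGrading (I12 k n a b c d))
          (reesT (iTwo k n a b c d e ^ 3) (iTwo_cube_mem_I12 k n a b c d e) *
            reesT (jThreeTwo k n a b c d e ^ 2) (jThreeTwo_sq_mem_I12 k n a b c d e)) ≃+*
        Γ((O₂.1 : Scheme.{0}), (O₂.1.ι ≫ affineBlowup.π (I12 k n a b c d) ≫ qσ) ⁻¹ᵁ ⊤)),
      (∀ (g : ↥(Subgroup.zpowers σ)) x, ((φ g x : reesAlgebra (I12 k n a b c d)) :
          (MvPolynomial (Fin n) k)[X]) =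
        (x : (MvPolynomial (Fin n) k)[X]).map ((MulSemiringAction.toRingEquiv
          (↥(Subgroup.zpowers σ)) (MvPolynomial (Fin n) k) g⁻¹ : _ ≃+* _) : _ →+* _)) ∧
      (∀ f : MvPolynomial (Fin n) k,
        O₂.1.ι.appLE (blowupChart (affineBlowup.π (I12 k n a b c d))
          (affineBlowup.idealSheaf (I12 k n a b c d)) ⟨⊤, isAffineOpen_top _⟩ (ι₀ (iTwo k n a b c d e ^ 3)))
          ((O₂.1.ι ≫ affineBlowup.π (I12 k n a b c d) ≫ qσ) ⁻¹ᵁ ⊤) hle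
          ((affineBlowup.π (I12 k n a b c d)).appLE ⊤
            (blowupChart (affineBlowup.π (I12 k n a b c d))
          (affineBlowup.idealSheaf (I12 k n a b c d)) ⟨⊤, isAffineOpen_top _⟩ (ι₀ (iTwo k n a b c d e ^ 3)))
            (blowupChart_le_preimage _ _ _ _) (ι₀ f)) =
        Ω (((fromZeroRingHom (reesGrading (I12 k n a b c d)) (.powers _)).comp
          (reesGrading.zeroRingHom (I12 k n a b c d))) f)) ∧
      (∀ (g : ↥(Subgroup.zpowers σ)) y, (ρB.restrict O₂.1 O₂.2.1).act g ⊤ (Ω y) =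
        Ω (HomogeneousLocalization.map (φ g⁻¹) (hP g⁻¹) y)) ∧
      (∀ y, Ω y ∈ (ρB.restrict O₂.1 O₂.2.1).invariantsRing ⊤ ↔
        ∀ g, HomogeneousLocalization.map (φ g) (hP g) y = y) := by
  have H := exists_sectionsEquiv_chartW₂ k n σ a b c d e hab hac had hae hb hc hd he hσ hI ρ hρ hJρ ρB haut O₂ hO₂
  rcases H with ⟨φ, hP, Ω, hφ, hΩi, hΩii, hΩiii⟩
  refine ⟨φ, hP, Ω, hφ, fun f => ?_, hΩii, hΩiii⟩
  -- (i') from (i) by composing the two `appLE`s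
  rw [← CommRingCat.comp_apply, Scheme.Hom.appLE_comp_appLE]
  exact (hΩi f).symm

end Summit.ResolutionOfSingularities.ResolutionOfSingularities.Theorems.WildQuotientResolution.JordanFive

end
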